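import Summits.AtomisticToContinuum.FouriersLaw.Theorems.OddSectorIrreversibilityOddDensityIsCorrector
import Summits.AtomisticToContinuum.FouriersLaw.Theorems.OddSectorIrreversibilityCorrectorTheoryExistence

/-!
# Weighted odd differentiability in quadratic mean (stub S_H2 of line `hellinger-logmean`), I: the weight is removable

Helper file 1 (`--supports stmt-AtomisticToContinuum-9121`, crux
`BondHeatUncertainty.ExtensiveSnapshotIrreversibility`) for stub `stub_weightedOddDQM` (S_H2) of line
`hellinger-logmean`: clause (i) of the stub, the REMOVABILITY OF THE WEIGHT `cosh(η(1+H))` against the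
squared odd response density.

Setting: pinned anharmonic chain `P = pinnedChain ω₂ lam β γ` (all parameters `> 0`), weak-NESS
uniqueness (U), a steady-state family `μ`, `T > 0`, `N ≥ 2`, and an `L²` linear-response density `h`
of the family at `T_L - T_R = δ → 0` (the hypothesis block of items 9144/9146), `Θ(q,p) = (q,-p)`.

* `oddResponse_sq_ae_le_exp` — **the odd response density is of exponential class**: for every
  `0 < ϑ`, `2ϑ < 1/T` there is `C ≥ 0` with `(h - h∘Θ)² ≤ C e^{2ϑH}` `μ_T`-a.e.  By (U) the state at
  `δ = 0` is the Gibbs measure `μ_T`; by the McLennan/KDN identity (`oddDensityIsCorrector_proof`,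
  item 9146) `h - h∘Θ = (u - u∘Θ)/((N-1)T²)` a.e. for an a.e. limit `u` of the finite-horizon Kubo
  correctors, which converge EVERYWHERE to `u⋆` with `|u⋆| ≤ K e^{ϑH}` (`Corrector.corrector_exists`),
  so `u = u⋆` a.e., `u∘Θ = u⋆∘Θ` a.e. (`Θ` preserves `μ_T`) and `H∘Θ = H`.
* `integrable_oddResponse_sq_mul_cosh` — `(h - h∘Θ)² cosh(η(1+H)) ∈ L¹(μ_{N,T,T})` for `|η| < 1/T`
  (`cosh x ≤ e^{|x|}`, `e^{θH} ∈ L¹(μ_T)` for `θ < 1/T`, `pinnedChain_integrable_exp_mul_hamiltonian_gibbsMeasure`).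
* `continuousAt_integral_oddResponse_sq_mul_cosh` — `η ↦ ∫ (h - h∘Θ)² cosh(η(1+H)) dμ_{N,T,T}` is
  continuous at `η = 0` (dominated convergence, bound `C e^{η₁} e^{(2ϑ+η₁)H}`, `η₁ = 1/(4T)`,
  `ϑ = 1/(8T)`).
* `oddResponse_weight_removable` — hence for every `η₀ > 0` and every `K' > ∫ (h - h∘Θ)² dμ_{N,T,T}`
  there is `η ∈ (0, η₀)` with `∫ (h - h∘Θ)² cosh(η(1+H)) dμ_{N,T,T} < K'` (clause (i) of S_H2 for
  every `η₀`).
* `helper_weightedOddDQMWeight` — the registered closed form (integrability ∧ weight removal).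

References: Kundu–Dhar–Narayan, J. Stat. Mech. (2009) L03001 (the corrector identity);
Cuneo–Eckmann–Hairer–Rey-Bellet, EJP 23 (2018) no. 55, Thm 2.13 (exponential moments, mixing);
folklore (dominated convergence). No definitions; nothing here closes the item.
-/

noncomputable section

namespace Summit.AtomisticToContinuum.FouriersLaw.Theorems.ExtensiveSnapshotIrreversibility.HellingerLogMean

open MeasureTheory Filter Topology Set
open scoped ENNReal NNReal ContDiff
open Literature.MathematicalPhysics.KineticTheory.HeatConduction
open Summit.AtomisticToContinuum.FouriersLaw.Theorems.OddSectorIrreversibility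
open Summit.AtomisticToContinuum.FouriersLaw.Theorems.OddSectorIrreversibility.Corrector

variable {N : ℕ}

/-! ## Elementary facts -/

/-- `cosh(η(1+H)) ≤ e^{η₁} e^{η₁ H}` for `|η| ≤ η₁` and `H ≥ 0` (`cosh x ≤ e^{|x|}`, cf.
`Literature.Analysis.Complex.DeBruijn1950.cosh_le_exp_abs`). [folklore] -/
theorem cosh_mul_one_add_le {η η₁ H : ℝ} (hη : |η| ≤ η₁) (hH : 0 ≤ H) :
    Real.cosh (η * (1 + H)) ≤ Real.exp η₁ * Real.exp (η₁ * H) := by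
  have hcosh : Real.cosh (η * (1 + H)) ≤ Real.exp |η * (1 + H)| := by
    rw [Real.cosh_eq]
    have h1 : Real.exp (η * (1 + H)) ≤ Real.exp |η * (1 + H)| := Real.exp_le_exp.2 (le_abs_self _)
    have h2 : Real.exp (-(η * (1 + H))) ≤ Real.exp |η * (1 + H)| := Real.exp_le_exp.2 (neg_le_abs _)
    linarith
  rw [← Real.exp_add]
  refine hcosh.trans (Real.exp_le_exp.2 ?_)
  rw [abs_mul, abs_of_nonneg (by linarith : (0 : ℝ) ≤ 1 + H)]
  nlinarith [abs_nonneg η]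

/-! ## The odd response density is of exponential class -/

section Pinned

variable {ω₂ lam β γ : ℝ} (hω : 0 < ω₂) (hl : 0 < lam) (hβ : 0 < β) (hγ : 0 < γ)
  (hU : ∀ (N : ℕ) (T_L T_R : ℝ), 0 < T_L → 0 < T_R → ∀ μ ν : Measure (PhaseSpace N),
    (pinnedChain ω₂ lam β γ).IsSteadyState N T_L T_R μ →
    (pinnedChain ω₂ lam β γ).IsSteadyState N T_L T_R ν → μ = ν)
  {μ : (N : ℕ) → ℝ → ℝ → Measure (PhaseSpace N)}
  (hμ : ∀ (N : ℕ) (T_L T_R : ℝ), 0 < T_L → 0 < T_R →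
    (pinnedChain ω₂ lam β γ).IsSteadyState N T_L T_R (μ N T_L T_R))
  {T : ℝ} (hT : 0 < T) (hN : 2 ≤ N) {h : PhaseSpace N → ℝ}
  (hh : MemLp h 2 (μ N T T) ∧
    (∀ F : PhaseSpace N → ℝ, ContDiff ℝ ((⊤ : ℕ∞) : WithTop ℕ∞) F → HasCompactSupport F →
      Tendsto (fun δ : ℝ => ((∫ x, F x ∂(μ N (T + δ / 2) (T - δ / 2))) - ∫ x, F x ∂(μ N T T)) / δ)
        (𝓝[≠] (0 : ℝ)) (𝓝 (∫ x, F x * h x ∂(μ N T T)))) ∧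
    (∀ i : Fin N, Tendsto (fun δ : ℝ =>
        ((∫ x, (pinnedChain ω₂ lam β γ).bondCurrent N i x ∂(μ N (T + δ / 2) (T - δ / 2))) -
          ∫ x, (pinnedChain ω₂ lam β γ).bondCurrent N i x ∂(μ N T T)) / δ)
        (𝓝[≠] (0 : ℝ)) (𝓝 (∫ x, (pinnedChain ω₂ lam β γ).bondCurrent N i x * h x ∂(μ N T T)))))
include hω hl hβ hγ hU hμ hT hN hh

omit hγ hN hh in
/-- Under weak-NESS uniqueness the steady state at `T_L = T_R = T` is the Gibbs measure. [folklore] -/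
theorem ness_eq_gibbs : μ N T T = (pinnedChain ω₂ lam β γ).gibbsMeasure N T :=
  hU N T T hT hT _ _ (hμ N T T hT hT) (pinnedChain_isSteadyState_gibbsMeasure hω hl.le hβ.le γ N hT)

omit hγ hN in
/-- The squared odd response density `(h - h∘Θ)²` is a.e.-strongly measurable for `μ_{N,T,T}`
(`h ∈ L²`, `Θ` preserves the Gibbs measure). [folklore] -/
theorem aestronglyMeasurable_oddResponse_sq :
    AEStronglyMeasurable (fun x : PhaseSpace N => (h x - h (x.1, -x.2)) ^ 2) (μ N T T) := by
  have hG := ness_eq_gibbs (N := N) hω hl hβ hU hμ hT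
  obtain ⟨hmem, -, -⟩ := hh
  rw [hG] at hmem ⊢
  have hqmp := (measurePreserving_reversal_gibbsMeasure (pinnedChain ω₂ lam β γ) N T).quasiMeasurePreserving
  have h1 : AEStronglyMeasurable (fun x : PhaseSpace N => h (x.1, -x.2))
      ((pinnedChain ω₂ lam β γ).gibbsMeasure N T) :=
    hmem.1.comp_quasiMeasurePreserving hqmp
  exact (hmem.1.sub h1).pow 2

/-- **The odd response density is of exponential class.** For every `0 < ϑ` with `2ϑ < 1/T` there is
`C ≥ 0` with `(h - h∘Θ)² ≤ C e^{2ϑH}` `μ_{N,T,T}`-a.e.: the McLennan/KDN identity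
`h - h∘Θ = (u - u∘Θ)/((N-1)T²)` (`oddDensityIsCorrector_proof`) and the growth bound `|u⋆| ≤ K e^{ϑH}` of
the everywhere-defined Kubo corrector `u⋆ = u` a.e. (`corrector_exists`).
[cite: KunduDharNarayan2009, eqs. (reln2)–(reln3)] [cite: CuneoEckmannHairerReyBellet2018, Thm 2.13] -/
theorem oddResponse_sq_ae_le_exp {ϑ : ℝ} (hϑ : 0 < ϑ) (h2ϑ : 2 * ϑ < 1 / T) :
    ∃ C : ℝ, 0 ≤ C ∧ ∀ᵐ x ∂(μ N T T), (h x - h (x.1, -x.2)) ^ 2 ≤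
      C * Real.exp (2 * ϑ * (pinnedChain ω₂ lam β γ).hamiltonian N x) := by
  have hG := ness_eq_gibbs (N := N) hω hl hβ hU hμ hT
  have hN0 : 0 < N := by omega
  set P := pinnedChain ω₂ lam β γ with hP
  set J : PhaseSpace N → ℝ := fun y => ∑ i : Fin N, P.bondCurrent N i y with hJ
  -- the McLennan / KDN identity
  obtain ⟨u, -, hlim, hid⟩ := oddDensityIsCorrector_proof ω₂ lam β γ hω hl hβ hγ hU μ hμ T hT N h hN hh
  rw [hG] at hlim hid ⊢
  -- the everywhere-defined corrector `u⋆ = w` and its growth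
  obtain ⟨K, c, hK0, -, -, -, hwb, -, hpt, -, -, -⟩ := corrector_exists hω hl hβ hγ hT hN0 hϑ h2ϑ
    (fun s z => ∫ y, J y ∂(P.transitionKernel N T T s.toNNReal z)) rfl
    (fun z => ∫ s in Set.Ioi (0 : ℝ), ∫ y, J y ∂(P.transitionKernel N T T s.toNNReal z)) rfl
  set w : PhaseSpace N → ℝ := fun z => ∫ s in Set.Ioi (0 : ℝ), ∫ y, J y
    ∂(P.transitionKernel N T T s.toNNReal z) with hw
  -- `u = w` a.e. and `u∘Θ = w∘Θ` a.e.
  have huw : ∀ᵐ x ∂(P.gibbsMeasure N T), u x = w x := by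
    filter_upwards [hlim] with x hx
    exact tendsto_nhds_unique hx (hpt x)
  have hqmp := (measurePreserving_reversal_gibbsMeasure P N T).quasiMeasurePreserving
  have huwΘ : ∀ᵐ x ∂(P.gibbsMeasure N T), u (x.1, -x.2) = w (x.1, -x.2) := by
    have h1 := hqmp.ae huw
    simpa only [momentumReversal_apply] using h1
  -- constants
  have hc0 : 0 < ((N : ℝ) - 1) * T ^ 2 := by
    have : (1 : ℝ) < N := by exact_mod_cast (lt_of_lt_of_le (by norm_num) hN)
    have hT2 : 0 < T ^ 2 := by positivity
    nlinarith
  refine ⟨(2 * K / (((N : ℝ) - 1) * T ^ 2)) ^ 2, sq_nonneg _, ?_⟩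
  filter_upwards [hid, huw, huwΘ] with x e1 e2 e3
  have hHΘ : P.hamiltonian N (x.1, -x.2) = P.hamiltonian N x := OscillatorChain.hamiltonian_neg_momentum P N x
  have hb1 : |w x| ≤ K * Real.exp (ϑ * P.hamiltonian N x) := hwb x
  have hb2 : |w (x.1, -x.2)| ≤ K * Real.exp (ϑ * P.hamiltonian N x) := by rw [← hHΘ]; exact hwb _
  have hdiff : |w x - w (x.1, -x.2)| ≤ 2 * K * Real.exp (ϑ * P.hamiltonian N x) :=
    (abs_sub _ _).trans (by linarith)
  have hexpsq : Real.exp (ϑ * P.hamiltonian N x) ^ 2 = Real.exp (2 * ϑ * P.hamiltonian N x) := by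
    rw [← Real.exp_nat_mul]; ring_nf
  rw [e1, e2, e3]
  have key : (w x - w (x.1, -x.2)) ^ 2 ≤ (2 * K) ^ 2 * Real.exp (2 * ϑ * P.hamiltonian N x) := by
    rw [← hexpsq]
    calc (w x - w (x.1, -x.2)) ^ 2 = |w x - w (x.1, -x.2)| ^ 2 := (sq_abs _).symm
      _ ≤ (2 * K * Real.exp (ϑ * P.hamiltonian N x)) ^ 2 := pow_le_pow_left₀ (abs_nonneg _) hdiff 2
      _ = (2 * K) ^ 2 * Real.exp (ϑ * P.hamiltonian N x) ^ 2 := by ring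
  calc ((w x - w (x.1, -x.2)) / (((N : ℝ) - 1) * T ^ 2)) ^ 2
      = (w x - w (x.1, -x.2)) ^ 2 / (((N : ℝ) - 1) * T ^ 2) ^ 2 := by rw [div_pow]
    _ ≤ (2 * K) ^ 2 * Real.exp (2 * ϑ * P.hamiltonian N x) / (((N : ℝ) - 1) * T ^ 2) ^ 2 :=
        div_le_div_of_nonneg_right key (sq_nonneg _)
    _ = (2 * K / (((N : ℝ) - 1) * T ^ 2)) ^ 2 * Real.exp (2 * ϑ * P.hamiltonian N x) := by
        rw [div_pow]; ring

/-- **Domination of the weighted odd response.** For `0 ≤ η₁ < 1/T` there is an integrable `bound` with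
`|(h - h∘Θ)² cosh(η(1+H))| ≤ bound` `μ_{N,T,T}`-a.e. for every `|η| ≤ η₁`
(`bound = C e^{η₁} e^{(2ϑ+η₁)H}`, `2ϑ = (1/T - η₁)/2`). [folklore] -/
theorem exists_dominator_oddResponse_sq_mul_cosh {η₁ : ℝ} (hη₁ : 0 ≤ η₁) (hη₁T : η₁ < 1 / T) :
    ∃ bound : PhaseSpace N → ℝ, Integrable bound (μ N T T) ∧
      ∀ η : ℝ, |η| ≤ η₁ → ∀ᵐ x ∂(μ N T T), ‖(h x - h (x.1, -x.2)) ^ 2 *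
        Real.cosh (η * (1 + (pinnedChain ω₂ lam β γ).hamiltonian N x))‖ ≤ bound x := by
  have hG := ness_eq_gibbs (N := N) hω hl hβ hU hμ hT
  set P := pinnedChain ω₂ lam β γ with hP
  set ϑ : ℝ := (1 / T - η₁) / 4 with hϑ
  have hϑ0 : 0 < ϑ := by rw [hϑ]; linarith
  have h2ϑ : 2 * ϑ < 1 / T := by rw [hϑ]; linarith
  have hsum : 2 * ϑ + η₁ < 1 / T := by rw [hϑ]; linarith
  obtain ⟨C, hC0, hae⟩ := oddResponse_sq_ae_le_exp hω hl hβ hγ hU hμ hT hN hh hϑ0 h2ϑ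
  refine ⟨fun x => C * Real.exp η₁ * Real.exp ((2 * ϑ + η₁) * P.hamiltonian N x), ?_, fun η hη => ?_⟩
  · rw [hG]
    exact (pinnedChain_integrable_exp_mul_hamiltonian_gibbsMeasure hω hl.le hβ.le γ N hT hsum).const_mul _
  · filter_upwards [hae] with x hx
    have hH0 : 0 ≤ P.hamiltonian N x := pinnedChain_hamiltonian_nonneg hω.le hl.le hβ.le γ N x
    have hcosh := cosh_mul_one_add_le hη hH0
    have hcosh0 : 0 ≤ Real.cosh (η * (1 + P.hamiltonian N x)) := (Real.cosh_pos _).le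
    rw [Real.norm_eq_abs, abs_of_nonneg (mul_nonneg (sq_nonneg _) hcosh0)]
    calc (h x - h (x.1, -x.2)) ^ 2 * Real.cosh (η * (1 + P.hamiltonian N x))
        ≤ (C * Real.exp (2 * ϑ * P.hamiltonian N x)) * (Real.exp η₁ * Real.exp (η₁ * P.hamiltonian N x)) :=
          mul_le_mul hx hcosh hcosh0 (by positivity)
      _ = C * Real.exp η₁ * Real.exp ((2 * ϑ + η₁) * P.hamiltonian N x) := by
          rw [add_mul, Real.exp_add]; ring

omit hγ hN in
/-- The weighted odd response `(h - h∘Θ)² cosh(η(1+H))` is a.e.-strongly measurable. [folklore] -/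
theorem aestronglyMeasurable_oddResponse_sq_mul_cosh (η : ℝ) :
    AEStronglyMeasurable (fun x : PhaseSpace N => (h x - h (x.1, -x.2)) ^ 2 *
      Real.cosh (η * (1 + (pinnedChain ω₂ lam β γ).hamiltonian N x))) (μ N T T) := by
  refine (aestronglyMeasurable_oddResponse_sq hω hl hβ hU hμ hT hh).mul
    (Continuous.aestronglyMeasurable ?_)
  exact Real.continuous_cosh.comp (continuous_const.mul (continuous_const.add
    (pinnedChain_continuous_hamiltonian ω₂ lam β γ N)))

/-- **Integrability of the weighted odd response**: `(h - h∘Θ)² cosh(η(1+H)) ∈ L¹(μ_{N,T,T})` for every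
`|η| < 1/T`. [folklore] -/
theorem integrable_oddResponse_sq_mul_cosh {η : ℝ} (hη : |η| < 1 / T) :
    Integrable (fun x : PhaseSpace N => (h x - h (x.1, -x.2)) ^ 2 *
      Real.cosh (η * (1 + (pinnedChain ω₂ lam β γ).hamiltonian N x))) (μ N T T) := by
  obtain ⟨bound, hbi, hb⟩ := exists_dominator_oddResponse_sq_mul_cosh hω hl hβ hγ hU hμ hT hN hh
    (abs_nonneg η) hη
  exact Integrable.mono' hbi (aestronglyMeasurable_oddResponse_sq_mul_cosh hω hl hβ hU hμ hT hh η)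
    (hb η le_rfl)

/-- **Continuity of the weighted odd response norm at `η = 0`**: dominated convergence with the bound of
`exists_dominator_oddResponse_sq_mul_cosh` at `η₁ = 1/(2T)` on the neighbourhood `[-η₁, η₁]` of `0`.
[folklore] -/
theorem continuousAt_integral_oddResponse_sq_mul_cosh :
    ContinuousAt (fun η : ℝ => ∫ x, (h x - h (x.1, -x.2)) ^ 2 *
      Real.cosh (η * (1 + (pinnedChain ω₂ lam β γ).hamiltonian N x)) ∂(μ N T T)) 0 := by
  have hη₁ : (0 : ℝ) < 1 / (2 * T) := by positivity
  have hη₁T : 1 / (2 * T) < 1 / T := by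
    rw [div_lt_div_iff₀ (by positivity) hT]; nlinarith
  obtain ⟨bound, hbi, hb⟩ := exists_dominator_oddResponse_sq_mul_cosh hω hl hβ hγ hU hμ hT hN hh hη₁.le hη₁T
  have hnhds : Set.Icc (-(1 / (2 * T))) (1 / (2 * T)) ∈ 𝓝 (0 : ℝ) := Icc_mem_nhds (by linarith) hη₁
  refine continuousAt_of_dominated (bound := bound) ?_ ?_ hbi ?_
  · exact Eventually.of_forall fun η =>
      aestronglyMeasurable_oddResponse_sq_mul_cosh hω hl hβ hU hμ hT hh η
  · filter_upwards [hnhds] with η hη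
    exact hb η (abs_le.2 ⟨hη.1, hη.2⟩)
  · exact Eventually.of_forall fun x =>
      (continuous_const.mul (Real.continuous_cosh.comp (continuous_id.mul continuous_const))).continuousAt

/-- **The weight is removable** (clause (i) of stub S_H2, for EVERY `η₀ > 0`): if
`∫ (h - h∘Θ)² dμ_{N,T,T} < K'` then `∫ (h - h∘Θ)² cosh(η(1+H)) dμ_{N,T,T} < K'` for some `η ∈ (0, η₀)`
(continuity at `η = 0`, `cosh 0 = 1`). [folklore] -/
theorem oddResponse_weight_removable {η₀ : ℝ} (hη₀ : 0 < η₀) {K' : ℝ}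
    (hK : ∫ x, (h x - h (x.1, -x.2)) ^ 2 ∂(μ N T T) < K') :
    ∃ η : ℝ, 0 < η ∧ η < η₀ ∧
      ∫ x, (h x - h (x.1, -x.2)) ^ 2 *
        Real.cosh (η * (1 + (pinnedChain ω₂ lam β γ).hamiltonian N x)) ∂(μ N T T) < K' := by
  have hcont := continuousAt_integral_oddResponse_sq_mul_cosh hω hl hβ hγ hU hμ hT hN hh
  have h0 : (fun η : ℝ => ∫ x, (h x - h (x.1, -x.2)) ^ 2 *
      Real.cosh (η * (1 + (pinnedChain ω₂ lam β γ).hamiltonian N x)) ∂(μ N T T)) 0 < K' := by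
    simpa only [zero_mul, Real.cosh_zero, mul_one] using hK
  have hev : ∀ᶠ η in 𝓝 (0 : ℝ), ∫ x, (h x - h (x.1, -x.2)) ^ 2 *
      Real.cosh (η * (1 + (pinnedChain ω₂ lam β γ).hamiltonian N x)) ∂(μ N T T) < K' :=
    hcont.eventually (gt_mem_nhds h0)
  have hev' : ∀ᶠ η in 𝓝[>] (0 : ℝ), 0 < η ∧ η < η₀ ∧ ∫ x, (h x - h (x.1, -x.2)) ^ 2 *
      Real.cosh (η * (1 + (pinnedChain ω₂ lam β γ).hamiltonian N x)) ∂(μ N T T) < K' := by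
    have h1 : ∀ᶠ η in 𝓝[>] (0 : ℝ), 0 < η := eventually_mem_nhdsWithin
    have h2 : ∀ᶠ η in 𝓝[>] (0 : ℝ), η < η₀ := (gt_mem_nhds hη₀).filter_mono nhdsWithin_le_nhds
    filter_upwards [h1, h2, hev.filter_mono nhdsWithin_le_nhds] with η a b c
    exact ⟨a, b, c⟩
  exact hev'.exists

end Pinned

/-! ## Registered helper stub -/

/-- **Registered helper stub of this file** (`helper_weightedOddDQMWeight`, sub-goal (i) of stub
`stub_weightedOddDQM` (S_H2) of crux stmt-AtomisticToContinuum-9121, line `hellinger-logmean`): under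
weak-NESS uniqueness, along a steady-state family, for `T > 0`, `N ≥ 2` and an `L²` response density
`h`: the weighted odd response `(h - h∘Θ)² cosh(η(1+H))` is `μ_{N,T,T}`-integrable for `|η| < 1/T`, and
for every `η₀ > 0`, `K' > ∫ (h - h∘Θ)² dμ_{N,T,T}` there is `η ∈ (0, η₀)` with
`∫ (h - h∘Θ)² cosh(η(1+H)) dμ_{N,T,T} < K'`.
[cite: KunduDharNarayan2009, eqs. (reln2)–(reln3)] [cite: CuneoEckmannHairerReyBellet2018, Thm 2.13] -/
theorem helper_weightedOddDQMWeight : ∀ ω₂ lam β γ : ℝ, 0 < ω₂ → 0 < lam → 0 < β → 0 < γ → (∀ (N : ℕ) (T_L T_R : ℝ), 0 < T_L → 0 < T_R → ∀ μ ν : Measure (PhaseSpace N), (pinnedChain ω₂ lam β γ).IsSteadyState N T_L T_R μ → (pinnedChain ω₂ lam β γ).IsSteadyState N T_L T_R ν → μ = ν) → ∀ μ : (N : ℕ) → ℝ → ℝ → Measure (PhaseSpace N), (∀ (N : ℕ) (T_L T_R : ℝ), 0 < T_L → 0 < T_R → (pinnedChain ω₂ lam β γ).IsSteadyState N T_L T_R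 (μ N T_L T_R)) → ∀ T : ℝ, 0 < T → ∀ N : ℕ, 2 ≤ N → ∀ h : PhaseSpace N → ℝ, (MemLp h 2 (μ N T T) ∧ (∀ F : PhaseSpace N → ℝ, ContDiff ℝ ((⊤ : ℕ∞) : WithTop ℕ∞) F → HasCompactSupport F → Tendsto (fun δ : ℝ => ((∫ x, F x ∂(μ N (T + δ / 2) (T - δ / 2))) - ∫ x, F x ∂(μ N T T)) / δ) (𝓝[≠] (0 : ℝ)) (𝓝 (∫ x, F x * h x ∂(μ N T T)))) ∧ (∀ i : Fin N, Tendsto (fun δ : ℝ => ((∫ x, (pinnedChain ω₂ lam β γ).bondCurrent N i x ∂(μ N (T + δ / 2) (T - δ / 2))) - ∫ x, (pinnedChain ω₂ lam β γ).bondCurrent N i x ∂(μ N T T)) / δ) (𝓝[≠] (0 : ℝ)) (𝓝 (∫ x, (pinnedChain ω₂ lam β γ).bondCurrent N i x * h x ∂(μ N T T))))) → (∀ η : ℝ, |η| < 1 / T → Integrable (fun x : PhaseSpace N => (h x - h (x.1, -x.2)) ^ 2 * Real.cosh (η * (1 + (pinnedChain ω₂ lam β γ).hamiltonian N x))) (μ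 N T T)) ∧ ∀ η₀ : ℝ, 0 < η₀ → ∀ K' : ℝ, ∫ x, (h x - h (x.1, -x.2)) ^ 2 ∂(μ N T T) < K' → ∃ η : ℝ, 0 < η ∧ η < η₀ ∧ ∫ x, (h x - h (x.1, -x.2)) ^ 2 * Real.cosh (η * (1 + (pinnedChain ω₂ lam β γ).hamiltonian N x)) ∂(μ N T T) < K' :=
  fun _ _ _ _ hω hl hβ hγ hU _ hμ _ hT _ hN _ hh =>
    ⟨fun _ hη => integrable_oddResponse_sq_mul_cosh hω hl hβ hγ hU hμ hT hN hh hη,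
      fun _ hη₀ _ hK => oddResponse_weight_removable hω hl hβ hγ hU hμ hT hN hh hη₀ hK⟩

end Summit.AtomisticToContinuum.FouriersLaw.Theorems.ExtensiveSnapshotIrreversibility.HellingerLogMean

end
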